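import Mathlib
import HarnessLib
import Summits.HubbardSuperconductivity.HubbardSuperconductivity.Theorems.KLProgrammeKLRegimeSplitLegStaging
import Summits.HubbardSuperconductivity.HubbardSuperconductivity.Theorems.KLProgrammeKLRegimeSplitTwoLegF

/-!
# Route `KLProgramme` — crux K3 split, ENGINE child `KLRegimeEngineV7` (stmt-HubbardSuperconductivity-19662): the TWO-LEG VERTEX ON A
# DRESSED LEG, read from the history slots — `SelfEnergySymmetric` + `RenormalisedAtF` + `TwoLegSlopes` at scale `m` bound
# `Σ_m(±ω₀, k⃗, σ)` on the shell `S_m` (cell gate-hubbard-kl, seat hubbard-kl-k3c2-p3, row «leg-dress bar»)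

The (D) leg-dressing term of the engine's value clauses ((E2-v5)/(E2″-v5)/(E2′-S2), `…SplitLegStaging`; Δ16 count repair
`…SplitLegCount`) is `ζ_n(ℓ)·λ_{n−1}` per dressed external leg `ℓ`, `ζ_n(ℓ) = g_n(±ω₀,ℓ)·W₂^{(n−1)}(±ω₀,ℓ)`.  The slice factor `g_n` is
bounded by `2/Λ_n` on its support (`klld_inv_radius_lt_of_weight_ne`); THIS module bounds the other factor, the two-leg vertex function
`W₂^{(m)}(±ω₀, k⃗, σ) = klSelfEnergy … m (omega0 M, k⃗) σ` of the scale-`m` action at the reading frequency, on the scale-`m` shell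
`S_m = {|e_K| ≤ Λ_m}`, by what the engine HOLDS about scale `m = n − 1` through `HistP`: the symmetry slot (E0) `SelfEnergySymmetric … m`
(time reversal `Σ(−ω₀) = conj Σ(ω₀)`, spin independence), the renormalisation slot `RenormalisedAtF … R m` (local part on the frame's curve
`|ν_m(θ)| ≤ cr·|U|·Λ_m²/e₀`) and the two-leg slot's (E3d/e) `TwoLegSlopes R … m` (field strength `|z_m − 1| ≤ cz|U|`, normal slope
`|Re Σ_m − ν_m(θ(k⃗))| ≤ cz|U|·|e_K(k⃗)|`):

  `‖Σ_m(±ω₀, k⃗, σ)‖ ≤ cr·|U|·Λ_m²/e₀ + cz·|U|·(|e_K(k⃗)| + π/β)`   (`klld_norm_selfEnergy_le_of_slots`),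

via the two identities `Re Σ_m(ω₀,k⃗,σ) = klLocSelfEnergyRe … m k⃗` and `Im Σ_m(ω₀,k⃗,σ) = (1 − z_m(k⃗))·(π/β)` under (E0)
(`klld_re_selfEnergy_eq_loc`, `klld_im_selfEnergy_eq`).  With `|e_K| ≤ Λ_{n−1} = 4Λ_n` on a dressed leg and `π/β ≤ Λ_{n_β}`, the product
with `2/Λ_n` is `≤ 32·cr·|U|·4^{−n} + 2cz|U|·(4 + (π/β)/Λ_n)` — the `R`-level sizes behind `legDressBarQ`'s staging (Δ15) and behind the
thermal-end count (Δ16).  Pure consequences of the slot texts; nothing about the model is asserted.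
-/

noncomputable section

namespace Summit.HubbardSuperconductivity.HubbardSuperconductivity.Theorems.KLRegimeSplit

set_option linter.dupNamespace false -- summit = problem name (single-conjunct summit), D-0017

open Real Finset Literature.MathematicalPhysics.QuantumLattice Literature.Probability.LatticeModels
open Summit.HubbardSuperconductivity.HubbardSuperconductivity.Theorems.KLProgrammeLegKernels

section Model

variable {L M : ℕ} [NeZero L] [NeZero M]

/-- Under (E0): **time reversal at the reading point** — `Re Σ_m(−ω₀,k⃗,σ) = Re Σ_m(ω₀,k⃗,σ)` and `Im Σ_m(−ω₀,k⃗,σ) = −Im Σ_m(ω₀,k⃗,σ)`. -/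
theorem klld_selfEnergy_rev_re_im {β U μ : ℝ} {K : TrigPolyC4v} {m : ℕ} (hE0 : SelfEnergySymmetric L M β U μ K m)
    (k : TorusSite 2 L) (σ : Fin 2) :
    (klSelfEnergy L M β U μ K klE0 m ((omega0 M).rev, k) σ).re = (klSelfEnergy L M β U μ K klE0 m (omega0 M, k) σ).re ∧
      (klSelfEnergy L M β U μ K klE0 m ((omega0 M).rev, k) σ).im = -(klSelfEnergy L M β U μ K klE0 m (omega0 M, k) σ).im := by
  rw [(hE0 k σ).1, Complex.conj_re, Complex.conj_im]
  exact ⟨rfl, rfl⟩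

/-- Under (E0): **spin independence at the reading point** — `Σ_m(ω₀,k⃗,σ) = Σ_m(ω₀,k⃗,0)`. -/
theorem klld_selfEnergy_spin {β U μ : ℝ} {K : TrigPolyC4v} {m : ℕ} (hE0 : SelfEnergySymmetric L M β U μ K m)
    (k : TorusSite 2 L) (σ : Fin 2) :
    klSelfEnergy L M β U μ K klE0 m (omega0 M, k) σ = klSelfEnergy L M β U μ K klE0 m (omega0 M, k) 0 :=
  (hE0 k σ).2.1

/-- Under (E0): **the localised two-leg value IS the real part of the vertex at the reading point**,
`klLocSelfEnergyRe … m k⃗ = Re Σ_m(ω₀,k⃗,σ)` (the spin- and `±ω₀`-average of four equal numbers). -/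
theorem klld_re_selfEnergy_eq_loc {β U μ : ℝ} {K : TrigPolyC4v} {m : ℕ} (hE0 : SelfEnergySymmetric L M β U μ K m)
    (k : TorusSite 2 L) (σ : Fin 2) :
    (klSelfEnergy L M β U μ K klE0 m (omega0 M, k) σ).re = klLocSelfEnergyRe L M β U μ K m k := by
  unfold klLocSelfEnergyRe
  rw [Fin.sum_univ_two, (klld_selfEnergy_rev_re_im hE0 k 0).1, (klld_selfEnergy_rev_re_im hE0 k 1).1,
    klld_selfEnergy_spin hE0 k 1, klld_selfEnergy_spin hE0 k σ]
  ring

/-- Under (E0): **the imaginary part at the reading point is the field-strength defect times the lowest frequency**,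
`Im Σ_m(ω₀,k⃗,σ) = (1 − z_m(k⃗))·(π/β)` (`z = klFieldStrength`, the centred difference quotient of `Im Σ` over `±ω₀`). -/
theorem klld_im_selfEnergy_eq {β U μ : ℝ} (hβ : 0 < β) {K : TrigPolyC4v} {m : ℕ} (hE0 : SelfEnergySymmetric L M β U μ K m)
    (k : TorusSite 2 L) (σ : Fin 2) :
    (klSelfEnergy L M β U μ K klE0 m (omega0 M, k) σ).im = (1 - klFieldStrength L M β U μ K m k) * (Real.pi / β) := by
  have hπβ : Real.pi / β ≠ 0 := (div_pos Real.pi_pos hβ).ne'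
  unfold klFieldStrength fieldStrength fieldStrengthSpin
  have h0 := (klld_selfEnergy_rev_re_im hE0 k 0).2
  have h1 := (klld_selfEnergy_rev_re_im hE0 k 1).2
  have hs1 := klld_selfEnergy_spin hE0 k 1
  have hsσ := klld_selfEnergy_spin hE0 k σ
  simp only [klSelfEnergy] at h0 h1 hs1 hsσ ⊢
  rw [h0, h1, hs1, hsσ]
  field_simp
  ring

/-- **The two-leg vertex on a dressed leg, from the history slots.**  At scale `m`, under (E0) `SelfEnergySymmetric … m`, the
renormalisation slot `RenormalisedAtF … R m` and the slopes (E3d/e) `TwoLegSlopes R … m`, for every momentum of the scale-`m` shell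
`S_m = {|e_K| ≤ Λ_m}` and every spin:
`‖Σ_m(ω₀, k⃗, σ)‖ ≤ cr·|U|·Λ_m²/e₀ + cz·|U|·(|e_K(k⃗)| + π/β)`. -/
theorem klld_norm_selfEnergy_le_of_slots {β U μ : ℝ} (hβ : 0 < β) {K : TrigPolyC4v} {R : RenConsts} {m : ℕ}
    (hE0 : SelfEnergySymmetric L M β U μ K m) (hren : RenormalisedAtF L M β U μ K R m) (hsl : TwoLegSlopes L M R β U μ K m)
    {k : TorusSite 2 L} (hk : k ∈ klShell L μ K m) (σ : Fin 2) :
    ‖klSelfEnergy L M β U μ K klE0 m (omega0 M, k) σ‖ ≤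
      R.cr * |U| * klScale klE0 m ^ 2 / klE0 + R.cz * |U| * (|nambuXiCT L μ K k| + Real.pi / β) := by
  set z := klSelfEnergy L M β U μ K klE0 m (omega0 M, k) σ with hz
  -- real part: local part on the curve + normal slope
  have hre : |z.re| ≤ R.cr * |U| * klScale klE0 m ^ 2 / klE0 + R.cz * |U| * |nambuXiCT L μ K k| := by
    rw [hz, klld_re_selfEnergy_eq_loc hE0 k σ]
    have h1 := hren (momentumAngle L k)
    have h2 := (hsl k hk).2
    have := abs_sub_abs_le_abs_sub (klLocSelfEnergyRe L M β U μ K m k) (klLocalPart L M β U μ K m (momentumAngle L k))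
    linarith
  -- imaginary part: field-strength defect times π/β
  have him : |z.im| ≤ R.cz * |U| * (Real.pi / β) := by
    rw [hz, klld_im_selfEnergy_eq hβ hE0 k σ, abs_mul, abs_of_pos (div_pos Real.pi_pos hβ)]
    have h1 := (hsl k hk).1
    rw [abs_sub_comm] at h1
    exact mul_le_mul_of_nonneg_right h1 (div_pos Real.pi_pos hβ).le
  calc ‖z‖ ≤ |z.re| + |z.im| := Complex.norm_le_abs_re_add_abs_im z
    _ ≤ _ := by linarith

/-- The same bound at the opposite reading frequency `−ω₀` (conjugate value under (E0)). -/
theorem klld_norm_selfEnergy_rev_le_of_slots {β U μ : ℝ} (hβ : 0 < β) {K : TrigPolyC4v} {R : RenConsts} {m : ℕ}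
    (hE0 : SelfEnergySymmetric L M β U μ K m) (hren : RenormalisedAtF L M β U μ K R m) (hsl : TwoLegSlopes L M R β U μ K m)
    {k : TorusSite 2 L} (hk : k ∈ klShell L μ K m) (σ : Fin 2) :
    ‖klSelfEnergy L M β U μ K klE0 m ((omega0 M).rev, k) σ‖ ≤
      R.cr * |U| * klScale klE0 m ^ 2 / klE0 + R.cz * |U| * (|nambuXiCT L μ K k| + Real.pi / β) := by
  rw [(hE0 k σ).1, Complex.norm_conj]
  exact klld_norm_selfEnergy_le_of_slots hβ hE0 hren hsl hk σ

/-- **On a leg inside the previous shell the bound is uniform**: for `k⃗ ∈ S_m` (`|e_K| ≤ Λ_m`),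
`‖Σ_m(ω₀,k⃗,σ)‖ ≤ cr·|U|·Λ_m²/e₀ + cz·|U|·(Λ_m + π/β)`. -/
theorem klld_norm_selfEnergy_le_uniform {β U μ : ℝ} (hβ : 0 < β) {K : TrigPolyC4v} {R : RenConsts} (hR : 0 ≤ R.cz) {m : ℕ}
    (hE0 : SelfEnergySymmetric L M β U μ K m) (hren : RenormalisedAtF L M β U μ K R m) (hsl : TwoLegSlopes L M R β U μ K m)
    {k : TorusSite 2 L} (hk : k ∈ klShell L μ K m) (σ : Fin 2) :
    ‖klSelfEnergy L M β U μ K klE0 m (omega0 M, k) σ‖ ≤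
      R.cr * |U| * klScale klE0 m ^ 2 / klE0 + R.cz * |U| * (klScale klE0 m + Real.pi / β) := by
  have hshell : |nambuXiCT L μ K k| ≤ klScale klE0 m := by
    unfold klShell momentumShell at hk
    exact (Finset.mem_filter.mp hk).2
  have h := klld_norm_selfEnergy_le_of_slots hβ hE0 hren hsl hk σ
  have hcz : 0 ≤ R.cz * |U| := mul_nonneg hR (abs_nonneg U)
  nlinarith

end Model

/-! ## The per-leg dressing size behind `legDressBarQ`: the slope factor (the residual factor `32·cr·|U|·4^{-n}` is
`klld_residual_dressing_arith` of `…SplitLegCount`) -/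

/-- **Slope part**: slice bound `2/Λ_n` times the normal-slope allowance `cz|U|·Λ_{n−1}` on the previous shell is the scale-free `8·cz·|U|`
(`n ≥ 1`) — the reason the slope dressing is NOT summable from the slot's `R`-level linear reading and is certified instead from the engine's
own second-order size of `∂_e Re Σ` (Δ15 (z): cubic part of `legDressBarQ`, `U ≤ U₀(R)`). -/
theorem klld_dressing_slope_part (cz U : ℝ) {n : ℕ} (hn : 1 ≤ n) :
    2 / klScale klE0 n * (cz * |U| * klScale klE0 (n - 1)) = 8 * cz * |U| := by
  obtain ⟨m, rfl⟩ := Nat.exists_eq_add_of_le hn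
  rw [show 1 + m - 1 = m by omega, show 1 + m = m + 1 by omega]
  have he : (0 : ℝ) < klE0 := by norm_num [klE0]
  have h4 : (0 : ℝ) < (4 : ℝ) ^ m := by positivity
  simp only [klScale, pow_succ]
  field_simp
  ring

end Summit.HubbardSuperconductivity.HubbardSuperconductivity.Theorems.KLRegimeSplit

end
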